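import Literature.MathematicalPhysics.QuantumFieldTheory.Balaban1983to89.B11Eq111FrakG
import Literature.MathematicalPhysics.QuantumFieldTheory.Balaban1983to89.B9Eq311L2Pairing

/-!
# `Balaban1983to89.B11Eq103H1Complex` — T. Bałaban, *The variational problem and background fields in renormalization group method
# for lattice gauge theories*, Commun. Math. Phys. **102** (1985) 277–309 [Balaban1985Variational] (45) p. 285, (103) p. 293,
# (110)–(111) p. 294, with [Balaban1985BackgroundPropagators] (3.3)/(3.8) pp. 390–392, (3.19)–(3.21) pp. 393–394, Thm 3.11 p. 416 and
# [Balaban1985Averaging] (18)–(19) p. 21: THE OPERATORS `G₁ = (Δ₁ + DRD* + aQ*Q)⁻¹`, `(QG₁Q*)⁻¹`, `H₁ = G₁Q*(QG₁Q*)⁻¹`, `R` OF (3.21)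
# AND `𝔊` ON `𝔤ᶜ`-VALUED LATTICE FUNCTIONS (complex Hilbert level, scalars `RCLike 𝕜`), and the letter (L6)
# `H₁ : NegSize L η levB 0 V →L[ℂ] Space115 L η lev₀ lev₁ ∇` ON THE CARRIERS OF `B11Eq115Space`

statement-level skeleton of published theorems with citation tags; proofs where landed; nothing here is a claim
about the Yang–Mills mass gap

PDF held: `paper:balaban1985-cmp102-variational-background` (journal page = PDF page + 276), `paper:balaban1985-cmp99-background-propagators`
(journal page = PDF page + 388), `paper:balaban1985-cmp98-averaging` (journal page = PDF page + 16); pp. 285, 293–294 / 390–394, 416 / 21 read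
by this seat (2026-08-21) in the held texts, (3.8)–(3.13) p. 392 on the render `pub-balaban/b2b-balaban-ref1/pages/1985-cmp99-background-propagators/…-p004-x2.png`.

THE PRINT (verbatim).
* [B11] p. 285: *«The operators Δ, Q and R define the operator H. Let us recall that it is an operator defined on configurations B and giving
  a minimum of the quadratic form ½⟨A, ΔA⟩ under the restrictions L^jηQ_jA = B on Λ_j, j = 0, 1, …, k, RD*A = 0. Thus it has the following
  properties L^jηQ_jHB = B on Λ_j, RD*HB = 0, (45)»*; p. 294: *«We denote by G₁ an inverse operator to the operator Δ₁ + DRD* + aQ*Q. … In [5]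
  we have proved that the operator G₁𝔓* is equal to the operator 𝔊 defined by (3.148) and satisfying the equalities Q𝔊 = 0, RD*𝔊 = 0.»*;
  (103) p. 293 `A′ = A₁ + H₁B`.
* [B9] p. 391: *«The adjoints are taken with respect to natural L² scalar products»*; (3.8) p. 392 `(D*A)(x) = Σ_μ η⁻¹(R(U(x, x − ηe_μ))A(x − ηe_μ, x)
  − A(x, x + ηe_μ))`; p. 393: *«These definitions extend straightforwardly to configurations U, A with values in the complexified group Gᶜ
  and algebra 𝔤ᶜ, see Sect. E in [5].»*; (3.20)–(3.21) p. 394: *«where R = R(U) is an orthogonal projection in the Hilbert space L²(Ω₀, 𝔤)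
  onto the subspace 𝓡 = … N(Q′) = {λ : Q′λ = 0}. (3.21)»*; Thm 3.11 p. 416: *«the operators Δ′_a, G′, (Q′G′²Q′*)⁻¹, Δ_a, G are positive
  definite. This is obvious for the first three operators»*.
* [B7] p. 21, (18)–(19): *«The scalar products define the corresponding norms. They are L² norms and are denoted by ‖ ‖, e.g., for a matrix X
  the norm is given by ‖X‖² = tr X*X. … In estimates we will use much more frequently another norm for matrices. It is the operator norm given
  by |X| = sup |Xψ| … (19)»*.

WHY THIS FILE (cell context).  pub-balaban NE9 letter map (B2′), letter **(L6)** — HOME/INBOX.md [NE9LEAF05-G62-PROPOSED-INBOX] «→ t4-ne9-p1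
(OWNER; (L6) `H1` next)»: type `H1 … : NegSize L η levB 0 𝔸 →L[ℂ] Space115 L η lev₀ lev₁ (nabla115 η U₀)` and supply the DATA LETTERS `G₁`,
`Qadj`, `Kinv` of `B11Eq111FrakG.frakG`/`frakGAt` «CONSTRUCTED from [B9] Thm 3.11's positivity (displayed) … complexified as for H₁».  The
owner's gen-76 files did this at the REAL Hilbert level (`B11Eq110GreenInverse`/`B11Eq110GreenLattice`: `InnerProductSpace ℝ`, hermitian
fibre).  The space (115) is COMPLEX (`𝔤ᶜ`-valued configurations, [B11] Prop. 6 / Sect. E analyticity), so this file redoes the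
construction ONCE over `RCLike 𝕜` scalars (print p. 393: the definitions «extend straightforwardly» to `𝔤ᶜ`; positivity becomes
`0 < re⟨x, Tx⟩`), instantiates it on the `η^d`-weighted `L²` spaces of `𝔤ᶜ`-valued lattice functions (`B9Eq311L2Pairing.WL2 𝕜`), where
`D* = D†` IS PROVED ((3.8), complex scalar `c = η⁻¹` real: `conj c = c`), `R := the orthogonal projection onto Δ_U N(Q′)` IS CONSTRUCTED
((3.21)–(3.23), `projR`/`RLatticeK` — one data letter fewer than gen 76; pub-balaban precision P-ne9leaf01-g65-1 adopted: onto the IMAGE `Δ_U N(Q′)`), and then READS `H₁` in the literal continuous-linear type of (115).  Print uses TWO norms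
on the fibre ([B7] (18)–(19)): the `L²`/Hilbert–Schmidt norm for the scalar products and the OPERATOR norm `|·|` for the sizes
`|·|_{(−n)}`, (115); accordingly the Hilbert fibre `W` (inner-product space) and the carrier fibre `V` of `B11Eq115Space` (normed
space) are two types identified by a linear `φ : W ≃ₗ[ℂ] V` (for `𝔤ᶜ ⊆ M_N(ℂ)`: the identity map between the two normings), and the
(115) letter is the underlying linear map transported along `φ` — continuity is automatic on the finite lattice.

WHAT IS DEFINED AND PROVED (sorry-free; no `Prop` placeholder; no inequality of the papers).
* §1 `greenK` — the inverse of an operator `T` with `0 < re⟨x, Tx⟩` (`x ≠ 0`) on a finite-dimensional `𝕜`-Hilbert space; `apply_greenK`,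
  `greenK_apply`, `re_inner_greenK_pos`.
* §2 abstract `𝕜`-Hilbert level: `laplaceAK Δ D R D* Q Q* a = Δ + DRD* + aQ*Q` ((110) / [B9] (3.26)); **`G1K`** with `laplaceAK_G1K`
  (`Δ_{1,a}G₁ = 1`); `re_inner_KK_pos` (`QG₁Q*` positive definite ⇐ `Q*` injective); **`KinvK`** = `(QG₁Q*)⁻¹` with **`hKK_holds`**
  (`QG₁Q*(QG₁Q*)⁻¹ = 1` — the `hK` of `B11Eq111FrakG`/`B11Eq129Minimizer`); **`H1K = G₁Q*(QG₁Q*)⁻¹`** with **`Q_H1K`** ((45) `Q(H₁b) = b`),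
  `H1K_injective`, `laplaceAK_H1K` (`Δ_{1,a}H₁b = Q*(QG₁Q*)⁻¹b`), `inner_laplaceAK_H1K_eq_zero`.
* §3 the lattice over `𝕜`: `sum_inner_covDeriv_eq_sum_inner_covDiv_K` ((3.8) is the `ℓ²`-adjoint of (3.3) for `𝕜`-inner-product fibres,
  `conj c = c`); `SiteL2K`/`BondL2K`; `covDerivL2K`/`covDivL2K` with **`adjoint_covDerivL2K`** (`D* = D†`); **`projR Δs Q′`** = `R` of (3.21) = the orthogonal projection onto
  `Δ_U N(Q′)` (`projR_isSymmetric`, `exists_ker_projR_eq` ((3.22) `Rf = Δ_Uλ₀`), `projR_apply_of_ker`, `projR_projR`); `covLaplaceSiteK` ((3.23) `D*D`),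
  **`RLatticeK`** (+ `_isSymmetric`, `_apply_of_ker`); `adjoint_injective_of_surjective`
  (`Q` onto ⇒ `Q†` injective, [B5] p. 25); **`laplaceALatticeK`**, **`G1LatticeK`**, **`KinvLatticeK`**, **`H1LatticeK`** with
  **`Q_H1LatticeK`**; **`frakGLatticeK`** = `B11Eq111FrakG.frakGLin` at the constructed letters, with `Q𝔊 = 0`, `RD*𝔊 = 0` from the displayed
  (3.124)-identities.
* §4 (`𝕜 = ℂ`) the (115) letter: `funEquiv φ w : WL2 ℂ w W ≃ₗ[ℂ] (ι → V)`; `blockCLM115` (a linear map of functions `(β → V) → (ι → V)` read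
  `NegSize L η levB 0 V →L[ℂ] Space115 L η lev₀ lev₁ Dc`, ANY `Dc`); **`H1CLM`** = (L6) with **`Q_H1CLM`** ((45) on the underlying
  functions); the function-level data letters `G1Fun`, `QFun`, `QadjFun`, `KinvFun`, `DFun`, `DstarFun` with **`hK_fun`**, so that
  `B11Eq111FrakG.frakG lev₁ Dc G1Fun QFun QadjFun KinvFun DFun Rr DstarFun` is `𝔊` with CONSTRUCTED letters, and **`chartHB115_typecheck`**:
  `chartHB115 (frakG …) Λ W J T ε₄ (H1CLM …)` is well-typed — (L2) and (L6) meet in ONE chart.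

MODEL / DECLARED READINGS.  (M1) fibre `W` = `𝔤ᶜ` with `⟨X, Y⟩ = tr X*Y` (any finite-dimensional `𝕜`-inner-product space); transporter
data `R`/`S` with `⟨R(b)v, u⟩ = ⟨v, S(b)u⟩` (= unitarity of `R(U(b))X = UXU⁻¹` for unitary `U(b)`: `S(b) = R(U(b)⁻¹)`); uniform weight
`c₀ = η^d`; block-field space `F` an abstract finite-dimensional inner-product space (its `(L^jη)^d`-weighted structure is `WL2` too); the
carrier fibre `V` and `φ` as above.  (M2) DISPLAYED, never asserted: positivity of `Δ_{1,a}` ([B9] Thm 3.11, as `hpos`), `Q` onto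
([B9] (3.19), `hQ`), the (3.124)-identities for `Q𝔊 = 0`, `RD*𝔊 = 0`.  (M3) NOT HERE (data): `Δ₁` as the Wilson Hessian (3.10) (principal
part typed in `B9Eq34CovCurlVector`; curvature part `Δ′` not), the averaging operators `Q = Q_k(U₀)` ([B7] (124)/(3.15)) and `Q′`
((3.19)), the numbers `a_j`; the second member of (45) `RD*H₁B = 0` is not derived (it needs the model identities of (M3)).
HONEST SCOPE.  [folklore] finite-dimensional Hilbert-space algebra around printed operator formulas + bookkeeping between the cell's own
carriers; no estimate of the papers ((46)/(117) stay displayed letters of the consumers); NOT summit progress (cell pub-balaban: NE9 NOT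
PRINTED / NOT PROVED; spine PROVED 0/9).  Filed by the pub-balaban NE9 BINDER-row owner lineage `b2b-balaban-t4-ne9-p1` (gen 77); a NEW
file importing `B11Eq111FrakG` (hence `B11Eq115Space`, `B9Eq33CovDerivVector`) and `B9Eq311L2Pairing`; nothing of lit-balaban's or of the
leaf seats' is modified.  Net new unproved facts: 0.  LENGTH NOTE: > 400 lines —
one module so that the (L6) letter, its Hilbert-level construction and the carrier transfer share ONE set of letters (§1–§4 are
consumed together by `chartOfLetters`); sequels go to new modules.
-/

noncomputable section

open scoped InnerProductSpace ComplexConjugate BigOperators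

namespace Literature.MathematicalPhysics.QuantumFieldTheory.Balaban1983to89.B11Eq103H1Complex

/-! ## §1 The inverse of an operator with positive definite real part `re⟨x, Tx⟩`, over `RCLike 𝕜` -/

section Green

variable {𝕜 : Type*} [RCLike 𝕜] {E : Type*} [NormedAddCommGroup E] [InnerProductSpace 𝕜 E]

/-- An operator with `0 < re⟨x, Tx⟩` for `x ≠ 0` is injective (the complex form of «positive definite», [B9] Thm 3.11).
[cite: Balaban1985BackgroundPropagators, Thm 3.11 p.416] -/
theorem injective_of_rePosDef {T : E →ₗ[𝕜] E} (hpos : ∀ x : E, x ≠ 0 → 0 < RCLike.re ⟪x, T x⟫_𝕜) : Function.Injective T := by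
  rw [← LinearMap.ker_eq_bot, LinearMap.ker_eq_bot']
  intro x hx
  by_contra h
  have := hpos x h
  rw [hx, inner_zero_right, map_zero] at this
  exact lt_irrefl 0 this

variable [FiniteDimensional 𝕜 E]

/-- … hence bijective (finite dimension). [cite: Balaban1985BackgroundPropagators, Thm 3.11 p.416] -/
theorem bijective_of_rePosDef {T : E →ₗ[𝕜] E} (hpos : ∀ x : E, x ≠ 0 → 0 < RCLike.re ⟪x, T x⟫_𝕜) : Function.Bijective T :=
  ⟨injective_of_rePosDef hpos, LinearMap.surjective_of_injective (injective_of_rePosDef hpos)⟩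

/-- **THE GREEN OPERATOR `T⁻¹`** of an operator with positive definite real part on a finite-dimensional `𝕜`-Hilbert space — [B11] p. 294's
«inverse operator», CONSTRUCTED (`LinearEquiv.ofBijective`) from the positivity asserted by [B9] Thm 3.11 (displayed as `hpos`, never proved
here); the `𝔤ᶜ`-valued («complexified», [B9] p. 393) form of `B11Eq110GreenInverse.green`.
[cite: Balaban1985Variational, (110) p.294; Balaban1985BackgroundPropagators, Thm 3.11 p.416] -/
def greenK (T : E →ₗ[𝕜] E) (hpos : ∀ x : E, x ≠ 0 → 0 < RCLike.re ⟪x, T x⟫_𝕜) : E →ₗ[𝕜] E :=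
  ((LinearEquiv.ofBijective T (bijective_of_rePosDef hpos)).symm : E ≃ₗ[𝕜] E)

variable {T : E →ₗ[𝕜] E} (hpos : ∀ x : E, x ≠ 0 → 0 < RCLike.re ⟪x, T x⟫_𝕜)

/-- `T (T⁻¹ x) = x`. [cite: Balaban1985Variational, (110) p.294] -/
@[simp] theorem apply_greenK (x : E) : T (greenK T hpos x) = x :=
  (LinearEquiv.ofBijective T (bijective_of_rePosDef hpos)).apply_symm_apply x

/-- `T⁻¹ (T x) = x`. [cite: Balaban1985Variational, (110) p.294] -/
@[simp] theorem greenK_apply (x : E) : greenK T hpos (T x) = x :=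
  (LinearEquiv.ofBijective T (bijective_of_rePosDef hpos)).symm_apply_apply x

/-- `T ∘ T⁻¹ = id`. [cite: Balaban1985Variational, (110) p.294] -/
theorem comp_greenK : T ∘ₗ greenK T hpos = LinearMap.id := LinearMap.ext (apply_greenK hpos)

/-- `T⁻¹ ∘ T = id`. [cite: Balaban1985Variational, (110) p.294] -/
theorem greenK_comp : greenK T hpos ∘ₗ T = LinearMap.id := LinearMap.ext (greenK_apply hpos)

/-- `T⁻¹` is injective. [cite: Balaban1985Variational, (110) p.294] -/
theorem greenK_injective : Function.Injective (greenK T hpos) :=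
  (LinearEquiv.ofBijective T (bijective_of_rePosDef hpos)).symm.injective

/-- **`T⁻¹` has positive definite real part**: `re⟨x, T⁻¹x⟩ = re⟨Ty, y⟩ = re⟨y, Ty⟩ > 0` with `y = T⁻¹x ≠ 0`.
[cite: Balaban1985BackgroundPropagators, Thm 3.11 p.416] -/
theorem re_inner_greenK_pos (x : E) (hx : x ≠ 0) : 0 < RCLike.re ⟪x, greenK T hpos x⟫_𝕜 := by
  have hy : greenK T hpos x ≠ 0 := fun h => hx (by rw [← apply_greenK hpos x, h, map_zero])
  have h := hpos (greenK T hpos x) hy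
  rw [apply_greenK] at h
  rwa [← inner_conj_symm, RCLike.conj_re]

end Green

/-! ## §2 `G₁ = (Δ₁ + DRD* + aQ*Q)⁻¹`, `(QG₁Q*)⁻¹`, `H₁ = G₁Q*(QG₁Q*)⁻¹` over `𝕜` (abstract Hilbert level) -/

section Operators

variable {𝕜 : Type*} [RCLike 𝕜] {E : Type*} [NormedAddCommGroup E] [InnerProductSpace 𝕜 E]
  {F : Type*} [NormedAddCommGroup F] [InnerProductSpace 𝕜 F] {S : Type*} [AddCommGroup S] [Module 𝕜 S]

/-- **`Δ_a = Δ + DRD* + aQ*Q`** ([B11] (110) p. 294 `Δ₁ + DRD* + aQ*Q`; [B9] (3.26) `Δ₁(U) = Δ(U) + D₁R(U)D₁* + Q*(U)aQ(U)`) over abstract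
`𝕜`-spaces — the `𝔤ᶜ`-valued form of lit-balaban's `B11Eq127EulerLagrange.laplaceA` (which is typed over `ℝ`).
[cite: Balaban1985Variational, (110) p.294; Balaban1985BackgroundPropagators, (3.26) p.395] -/
def laplaceAK (Δ : E →ₗ[𝕜] E) (D : S →ₗ[𝕜] E) (R : S →ₗ[𝕜] S) (Dstar : E →ₗ[𝕜] S) (Q : E →ₗ[𝕜] F) (Qadj : F →ₗ[𝕜] E) (a : 𝕜) :
    E →ₗ[𝕜] E :=
  Δ + D ∘ₗ R ∘ₗ Dstar + Qadj ∘ₗ (a • Q)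

/-- Unfolding `Δ_a x = Δx + D(R(D*x)) + Q*(a·Qx)`. [cite: Balaban1985Variational, (110) p.294] -/
theorem laplaceAK_apply (Δ : E →ₗ[𝕜] E) (D : S →ₗ[𝕜] E) (R : S →ₗ[𝕜] S) (Dstar : E →ₗ[𝕜] S) (Q : E →ₗ[𝕜] F) (Qadj : F →ₗ[𝕜] E)
    (a : 𝕜) (x : E) : laplaceAK Δ D R Dstar Q Qadj a x = Δ x + D (R (Dstar x)) + Qadj (a • Q x) := rfl

variable [FiniteDimensional 𝕜 E] {Δ : E →ₗ[𝕜] E} {D : S →ₗ[𝕜] E} {R : S →ₗ[𝕜] S} {Dstar : E →ₗ[𝕜] S} {Q : E →ₗ[𝕜] F} {Qadj : F →ₗ[𝕜] E} {a : 𝕜}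

/-- **`G₁ := (Δ₁ + DRD* + aQ*Q)⁻¹`**, CONSTRUCTED from the displayed positivity of `Δ_{1,a}` ([B9] Thm 3.11).
[cite: Balaban1985Variational, (110) p.294; Balaban1985BackgroundPropagators, Thm 3.11 p.416] -/
def G1K (Δ : E →ₗ[𝕜] E) (D : S →ₗ[𝕜] E) (R : S →ₗ[𝕜] S) (Dstar : E →ₗ[𝕜] S) (Q : E →ₗ[𝕜] F) (Qadj : F →ₗ[𝕜] E) (a : 𝕜)
    (hpos : ∀ x : E, x ≠ 0 → 0 < RCLike.re ⟪x, laplaceAK Δ D R Dstar Q Qadj a x⟫_𝕜) : E →ₗ[𝕜] E :=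
  greenK (laplaceAK Δ D R Dstar Q Qadj a) hpos

variable (hpos : ∀ x : E, x ≠ 0 → 0 < RCLike.re ⟪x, laplaceAK Δ D R Dstar Q Qadj a x⟫_𝕜)

/-- **`Δ_{1,a}(G₁x) = x`.** [cite: Balaban1985Variational, (110) p.294] -/
theorem laplaceAK_G1K (x : E) : laplaceAK Δ D R Dstar Q Qadj a (G1K Δ D R Dstar Q Qadj a hpos x) = x := apply_greenK hpos x

/-- `G₁(Δ_{1,a}x) = x`. [cite: Balaban1985Variational, (110) p.294] -/
theorem G1K_laplaceAK (x : E) : G1K Δ D R Dstar Q Qadj a hpos (laplaceAK Δ D R Dstar Q Qadj a x) = x := greenK_apply hpos x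

/-- `G₁` has positive definite real part. [cite: Balaban1985BackgroundPropagators, Thm 3.11 p.416] -/
theorem re_inner_G1K_pos (x : E) (hx : x ≠ 0) : 0 < RCLike.re ⟪x, G1K Δ D R Dstar Q Qadj a hpos x⟫_𝕜 := re_inner_greenK_pos hpos x hx

/-- **`K := QG₁Q*` has positive definite real part when `Q*` is injective** (= `Q` onto): `re⟨y, QG₁Q*y⟩ = re⟨Q*y, G₁Q*y⟩ > 0` for `y ≠ 0` —
the «obvious» positivity of the `(QGQ*)⁻¹`-type operators of [B9] Thm 3.11, here PROVED from that of `G₁` and the adjointness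
`⟨Qx, y⟩ = ⟨x, Q*y⟩`. [cite: Balaban1985BackgroundPropagators, Thm 3.11 p.416; Balaban1984PropagatorsI, p.25] -/
theorem re_inner_KK_pos (hadj : ∀ (x : E) (y : F), ⟪Q x, y⟫_𝕜 = ⟪x, Qadj y⟫_𝕜) (hQadj : Function.Injective Qadj) (y : F) (hy : y ≠ 0) :
    0 < RCLike.re ⟪y, (Q ∘ₗ G1K Δ D R Dstar Q Qadj a hpos ∘ₗ Qadj) y⟫_𝕜 := by
  have hQy : Qadj y ≠ 0 := fun h => hy (hQadj (by rw [h, map_zero]))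
  rw [LinearMap.comp_apply, LinearMap.comp_apply, ← inner_conj_symm, hadj, inner_conj_symm]
  exact re_inner_G1K_pos hpos (Qadj y) hQy

variable [FiniteDimensional 𝕜 F]

/-- **`(QG₁Q*)⁻¹`**, CONSTRUCTED. [cite: Balaban1985Variational, (45) p.285; Balaban1985BackgroundPropagators, Thm 3.11 p.416] -/
def KinvK (hadj : ∀ (x : E) (y : F), ⟪Q x, y⟫_𝕜 = ⟪x, Qadj y⟫_𝕜) (hQadj : Function.Injective Qadj) : F →ₗ[𝕜] F :=
  greenK (Q ∘ₗ G1K Δ D R Dstar Q Qadj a hpos ∘ₗ Qadj) (re_inner_KK_pos hpos hadj hQadj)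

/-- **`QG₁Q*(QG₁Q*)⁻¹ y = y`** — the hypothesis `hK` of `B11Eq111FrakG` / `B11Eq129Minimizer`, DISCHARGED BY CONSTRUCTION.
[cite: Balaban1985Variational, (45) p.285] -/
theorem hKK_holds (hadj : ∀ (x : E) (y : F), ⟪Q x, y⟫_𝕜 = ⟪x, Qadj y⟫_𝕜) (hQadj : Function.Injective Qadj) (y : F) :
    Q (G1K Δ D R Dstar Q Qadj a hpos (Qadj (KinvK hpos hadj hQadj y))) = y := by
  have h := apply_greenK (re_inner_KK_pos hpos hadj hQadj) y
  unfold KinvK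
  simpa only [LinearMap.comp_apply] using h

/-- **`H₁ := G₁Q*(QG₁Q*)⁻¹`** — the operator of (45)/(103) as an OBJECT over `𝕜` (so on `𝔤ᶜ`-valued configurations), determined by the
printed operators `Δ₁, D, R, D*, Q, Q*, a` and two displayed facts (positivity of `Δ_{1,a}`, injectivity of `Q*`).
[cite: Balaban1985Variational, (45) p.285, (103) p.293] -/
def H1K (hadj : ∀ (x : E) (y : F), ⟪Q x, y⟫_𝕜 = ⟪x, Qadj y⟫_𝕜) (hQadj : Function.Injective Qadj) : F →ₗ[𝕜] E :=
  G1K Δ D R Dstar Q Qadj a hpos ∘ₗ Qadj ∘ₗ KinvK hpos hadj hQadj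

/-- **(45), first member: `Q(H₁b) = b`.** [cite: Balaban1985Variational, (45) p.285] -/
theorem Q_H1K (hadj : ∀ (x : E) (y : F), ⟪Q x, y⟫_𝕜 = ⟪x, Qadj y⟫_𝕜) (hQadj : Function.Injective Qadj) (b : F) :
    Q (H1K hpos hadj hQadj b) = b := by
  unfold H1K
  simpa only [LinearMap.comp_apply] using hKK_holds hpos hadj hQadj b

/-- `H₁` is injective (a right inverse of `Q`). [cite: Balaban1985Variational, (45) p.285] -/
theorem H1K_injective (hadj : ∀ (x : E) (y : F), ⟪Q x, y⟫_𝕜 = ⟪x, Qadj y⟫_𝕜) (hQadj : Function.Injective Qadj) :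
    Function.Injective (H1K hpos hadj hQadj) :=
  Function.LeftInverse.injective (g := Q) (Q_H1K hpos hadj hQadj)

/-- **`Δ_{1,a}(H₁b) = Q*(QG₁Q*)⁻¹b ∈ range Q*`.** [cite: Balaban1985Variational, p.293, (129) p.297] -/
theorem laplaceAK_H1K (hadj : ∀ (x : E) (y : F), ⟪Q x, y⟫_𝕜 = ⟪x, Qadj y⟫_𝕜) (hQadj : Function.Injective Qadj) (b : F) :
    laplaceAK Δ D R Dstar Q Qadj a (H1K hpos hadj hQadj b) = Qadj (KinvK hpos hadj hQadj b) := by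
  rw [H1K, LinearMap.comp_apply, LinearMap.comp_apply, G1K, apply_greenK]

/-- `⟨δ, Δ_{1,a}(H₁b)⟩ = 0` whenever `Qδ = 0` («⟨δA′, Δ₁H₁B⟩ = 0», [B11] p. 293). [cite: Balaban1985Variational, p.293] -/
theorem inner_laplaceAK_H1K_eq_zero (hadj : ∀ (x : E) (y : F), ⟪Q x, y⟫_𝕜 = ⟪x, Qadj y⟫_𝕜) (hQadj : Function.Injective Qadj) (b : F)
    {δ : E} (hδ : Q δ = 0) : ⟪δ, laplaceAK Δ D R Dstar Q Qadj a (H1K hpos hadj hQadj b)⟫_𝕜 = 0 := by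
  rw [laplaceAK_H1K, ← hadj, hδ, inner_zero_left]

end Operators

/-! ## §3 The lattice over `𝕜`: `D* = D†` for `𝔤ᶜ`-valued functions, `R` = the orthogonal projection (3.21), and the letters instantiated -/

section Fibre

open B9SectCLatticeCarrier (Bond bpos btgt shift unshift)
open B4Sect5Torus (TSite)
open B9Eq33CovDerivVector (covDeriv covDiv covDeriv_apply_dir covDiv_apply shiftEquiv)

variable {𝕜 : Type*} [RCLike 𝕜] {d : ℕ} {Pd : Fin d → ℕ} {W : Type*} [NormedAddCommGroup W] [InnerProductSpace 𝕜 W]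

/-- **(3.8) is the `ℓ²`-adjoint of (3.3) for `𝕜`-inner-product fibres** (the `𝔤ᶜ`-valued case of
`B9Eq33CovDerivVector.sum_inner_covDeriv_eq_sum_inner_covDiv`): for a scalar `c` with `conj c = c` (print: `c = η⁻¹` real) and transporter
data with `⟨R(b)v, u⟩ = ⟨v, S(b)u⟩`, `Σ_b ⟨(Df)(b), A(b)⟩ = Σ_x ⟨f(x), (D*A)(x)⟩`. [cite: Balaban1985BackgroundPropagators, (3.8) p.392] -/
theorem sum_inner_covDeriv_eq_sum_inner_covDiv_K (c : 𝕜) (hc : conj c = c) (R S : Bond d Pd → W →ₗ[𝕜] W)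
    (hRS : ∀ (b : Bond d Pd) (v u : W), ⟪R b v, u⟫_𝕜 = ⟪v, S b u⟫_𝕜) (f : TSite d Pd → W) (A : Bond d Pd → W) :
    ∑ b, ⟪covDeriv c R f b, A b⟫_𝕜 = ∑ y, ⟪f y, covDiv c S A y⟫_𝕜 := by
  have key : ∀ μ : Fin d, ∑ x : TSite d Pd, ⟪f (shift μ x), S (x, μ) (A (x, μ))⟫_𝕜 =
      ∑ y : TSite d Pd, ⟪f y, S (unshift μ y, μ) (A (unshift μ y, μ))⟫_𝕜 :=
    fun μ => Fintype.sum_equiv (shiftEquiv μ) _ _ fun x => by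
      simp only [shiftEquiv, Equiv.coe_fn_mk, B9SectCLatticeCarrier.unshift_shift]
  calc ∑ b, ⟪covDeriv c R f b, A b⟫_𝕜
      = ∑ x, ∑ μ, (c * ⟪f (shift μ x), S (x, μ) (A (x, μ))⟫_𝕜 - c * ⟪f x, A (x, μ)⟫_𝕜) := by
        rw [Fintype.sum_prod_type]
        refine Finset.sum_congr rfl fun x _ => Finset.sum_congr rfl fun μ _ => ?_
        rw [covDeriv_apply_dir, inner_smul_left, hc, inner_sub_left, hRS, mul_sub]
    _ = ∑ μ, ∑ x, (c * ⟪f (shift μ x), S (x, μ) (A (x, μ))⟫_𝕜 - c * ⟪f x, A (x, μ)⟫_𝕜) := Finset.sum_comm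
    _ = ∑ μ, ∑ y, (c * ⟪f y, S (unshift μ y, μ) (A (unshift μ y, μ))⟫_𝕜 - c * ⟪f y, A (y, μ)⟫_𝕜) := by
        refine Finset.sum_congr rfl fun μ _ => ?_
        rw [Finset.sum_sub_distrib, Finset.sum_sub_distrib, ← Finset.mul_sum, ← Finset.mul_sum, key μ, ← Finset.mul_sum]
    _ = ∑ y, ∑ μ, (c * ⟪f y, S (unshift μ y, μ) (A (unshift μ y, μ))⟫_𝕜 - c * ⟪f y, A (y, μ)⟫_𝕜) := Finset.sum_comm
    _ = ∑ y, ⟪f y, covDiv c S A y⟫_𝕜 := by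
        refine Finset.sum_congr rfl fun y _ => ?_
        rw [covDiv_apply, inner_smul_right, inner_sum, Finset.mul_sum]
        refine Finset.sum_congr rfl fun μ _ => ?_
        rw [inner_sub_right, mul_sub]

end Fibre

section Lattice

open B9SectCLatticeCarrier (Bond)
open B4Sect5Torus (TSite)
open B9Eq33CovDerivVector (covDeriv covDiv)
open B9Eq311L2Pairing (WL2 adjoint_eq_of_sum_inner)
open B11Eq111FrakG (frakGLin apply_Q_frakGLin apply_RDstar_frakGLin)

variable (𝕜 : Type*) [RCLike 𝕜] {d : ℕ} {Pd : Fin d → ℕ} {W : Type*} [NormedAddCommGroup W] [InnerProductSpace 𝕜 W]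

/-- The `L²` space of `𝔤ᶜ`-valued SITE functions of `T_η`, uniform weight `c₀` (= `η^d`), scalars `𝕜`. [cite: Balaban1985BackgroundPropagators, p.391, (3.11) p.392] -/
abbrev SiteL2K (d : ℕ) (Pd : Fin d → ℕ) (c₀ : ℝ) (W : Type*) : Type _ := WL2 𝕜 (fun _ : TSite d Pd => c₀) W

/-- The `L²` space of `𝔤ᶜ`-valued BOND functions of `T_η`, uniform weight `c₀` (= `η^d`), scalars `𝕜` — the pairing (3.11).
[cite: Balaban1985BackgroundPropagators, (3.11) p.392] -/
abbrev BondL2K (d : ℕ) (Pd : Fin d → ℕ) (c₀ : ℝ) (W : Type*) : Type _ := WL2 𝕜 (fun _ : Bond d Pd => c₀) W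

variable {c₀ : ℝ} [Fact (0 < c₀)]

/-- **(3.3) `D` between the `L²` spaces over `𝕜`.** [cite: Balaban1985BackgroundPropagators, (3.3) pp.390–391] -/
def covDerivL2K (c₀ : ℝ) (c : 𝕜) (R : Bond d Pd → W →ₗ[𝕜] W) [Fact (0 < c₀)] : SiteL2K 𝕜 d Pd c₀ W →ₗ[𝕜] BondL2K 𝕜 d Pd c₀ W :=
  (WL2.linearEquiv 𝕜 𝕜 (fun _ : Bond d Pd => c₀)).symm.toLinearMap ∘ₗ covDeriv c R ∘ₗ
    (WL2.linearEquiv 𝕜 𝕜 (fun _ : TSite d Pd => c₀)).toLinearMap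

/-- **(3.8) `D*` between the `L²` spaces over `𝕜`.** [cite: Balaban1985BackgroundPropagators, (3.8) p.392] -/
def covDivL2K (c₀ : ℝ) (c : 𝕜) (S : Bond d Pd → W →ₗ[𝕜] W) [Fact (0 < c₀)] : BondL2K 𝕜 d Pd c₀ W →ₗ[𝕜] SiteL2K 𝕜 d Pd c₀ W :=
  (WL2.linearEquiv 𝕜 𝕜 (fun _ : TSite d Pd => c₀)).symm.toLinearMap ∘ₗ covDiv c S ∘ₗ
    (WL2.linearEquiv 𝕜 𝕜 (fun _ : Bond d Pd => c₀)).toLinearMap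

variable {𝕜}

/-- Unfolding: `covDerivL2K` is `covDeriv` read through the identifications. [cite: Balaban1985BackgroundPropagators, (3.3) pp.390–391] -/
theorem equiv_covDerivL2K (c : 𝕜) (R : Bond d Pd → W →ₗ[𝕜] W) (f : SiteL2K 𝕜 d Pd c₀ W) :
    WL2.equiv 𝕜 _ W (covDerivL2K 𝕜 c₀ c R f) = covDeriv c R (WL2.equiv 𝕜 _ W f) := rfl

/-- Unfolding: `covDivL2K` is `covDiv` read through the identifications. [cite: Balaban1985BackgroundPropagators, (3.8) p.392] -/
theorem equiv_covDivL2K (c : 𝕜) (S : Bond d Pd → W →ₗ[𝕜] W) (A : BondL2K 𝕜 d Pd c₀ W) :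
    WL2.equiv 𝕜 _ W (covDivL2K 𝕜 c₀ c S A) = covDiv c S (WL2.equiv 𝕜 _ W A) := rfl

variable [FiniteDimensional 𝕜 W]

/-- **`D* = D†` over `𝕜`**: on the periodic lattice with the uniform `η^d`-weights, for a scalar with `conj c = c` and mutually adjoint transporter
data, (3.8) IS `LinearMap.adjoint` of (3.3) on the `𝔤ᶜ`-valued `L²` spaces. [cite: Balaban1985BackgroundPropagators, (3.8) p.392] -/
theorem adjoint_covDerivL2K (c : 𝕜) (hc : conj c = c) (R S : Bond d Pd → W →ₗ[𝕜] W)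
    (hRS : ∀ (b : Bond d Pd) (v u : W), ⟪R b v, u⟫_𝕜 = ⟪v, S b u⟫_𝕜) :
    LinearMap.adjoint (covDerivL2K 𝕜 c₀ c R) = covDivL2K 𝕜 c₀ c S := by
  refine adjoint_eq_of_sum_inner _ _ fun f A => ?_
  simp only [← Finset.mul_sum, equiv_covDerivL2K, equiv_covDivL2K]
  congr 1
  exact sum_inner_covDeriv_eq_sum_inner_covDiv_K c hc R S hRS _ _

/-- Consequently `re⟨f, D*(Df)⟩ = ‖Df‖² ≥ 0`. [cite: Balaban1985BackgroundPropagators, (3.10) p.392] -/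
theorem inner_covDivL2K_covDerivL2K (c : 𝕜) (hc : conj c = c) (R S : Bond d Pd → W →ₗ[𝕜] W)
    (hRS : ∀ (b : Bond d Pd) (v u : W), ⟪R b v, u⟫_𝕜 = ⟪v, S b u⟫_𝕜) (f : SiteL2K 𝕜 d Pd c₀ W) :
    ⟪f, covDivL2K 𝕜 c₀ c S (covDerivL2K 𝕜 c₀ c R f)⟫_𝕜 = ((‖covDerivL2K 𝕜 c₀ c R f‖ : ℝ) : 𝕜) ^ 2 := by
  rw [← adjoint_covDerivL2K c hc R S hRS, LinearMap.adjoint_inner_right, inner_self_eq_norm_sq_to_K]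

end Lattice

/-! ### `R` of (3.21): the orthogonal projection onto `ℛ = Δ_U N(Q′)`, CONSTRUCTED -/

section Projection

variable {𝕜 : Type*} [RCLike 𝕜] {E : Type*} [NormedAddCommGroup E] [InnerProductSpace 𝕜 E] [FiniteDimensional 𝕜 E]
  {F' : Type*} [AddCommGroup F'] [Module 𝕜 F']

/-- **`R = R(U)`, the orthogonal projection onto `ℛ = Δ^η_U N(Q′)`, `N(Q′) = {λ : Q′λ = 0}`** ((3.21) p. 394) in the `L²` space of the gauge
parameters, as a linear map determined by the data `Δs` (the covariant Laplace operator (3.23) `Δ^η_U = D*_U D_U` on site functions) and `Q′`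
(Mathlib's `Submodule.starProjection` of `(ker Q′).map Δs`; finite dimension supplies the closedness).  [pub-balaban precision P-ne9leaf01-g65-1:
onto the IMAGE `Δ_U N(Q′)`, not onto `N(Q′)`.] [cite: Balaban1985BackgroundPropagators, (3.20)–(3.23) p.394] -/
def projR (Δs : E →ₗ[𝕜] E) (Q' : E →ₗ[𝕜] F') : E →ₗ[𝕜] E :=
  haveI : CompleteSpace ((LinearMap.ker Q').map Δs) := FiniteDimensional.complete 𝕜 _
  (((LinearMap.ker Q').map Δs).starProjection : E →L[𝕜] E).toLinearMap

/-- `R` is symmetric («orthogonal projection»). [cite: Balaban1985BackgroundPropagators, (3.21) p.394] -/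
theorem projR_isSymmetric (Δs : E →ₗ[𝕜] E) (Q' : E →ₗ[𝕜] F') : (projR Δs Q').IsSymmetric := by
  haveI : CompleteSpace ((LinearMap.ker Q').map Δs) := FiniteDimensional.complete 𝕜 _
  exact ((LinearMap.ker Q').map Δs).starProjection_isSymmetric

/-- **(3.22): `Rf = Δ_U λ₀` for some `λ₀ ∈ N(Q′)`** — the range of `R` is `Δ_U N(Q′)`. [cite: Balaban1985BackgroundPropagators, (3.22) p.394] -/
theorem exists_ker_projR_eq (Δs : E →ₗ[𝕜] E) (Q' : E →ₗ[𝕜] F') (f : E) : ∃ l : E, Q' l = 0 ∧ projR Δs Q' f = Δs l := by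
  haveI : CompleteSpace ((LinearMap.ker Q').map Δs) := FiniteDimensional.complete 𝕜 _
  obtain ⟨l, hl, h⟩ := Submodule.mem_map.1 (((LinearMap.ker Q').map Δs).starProjection_apply_mem f)
  exact ⟨l, LinearMap.mem_ker.1 hl, h.symm⟩

/-- **(3.21): `R` fixes `ℛ = Δ_U N(Q′)`** — `R(Δ_U λ) = Δ_U λ` for `Q′λ = 0`. [cite: Balaban1985BackgroundPropagators, (3.21) p.394] -/
theorem projR_apply_of_ker (Δs : E →ₗ[𝕜] E) (Q' : E →ₗ[𝕜] F') {l : E} (hl : Q' l = 0) : projR Δs Q' (Δs l) = Δs l := by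
  haveI : CompleteSpace ((LinearMap.ker Q').map Δs) := FiniteDimensional.complete 𝕜 _
  exact ((LinearMap.ker Q').map Δs).starProjection_eq_self_iff.2 (Submodule.mem_map_of_mem (LinearMap.mem_ker.2 hl))

/-- `R² = R`. [cite: Balaban1985BackgroundPropagators, (3.21) p.394] -/
theorem projR_projR (Δs : E →ₗ[𝕜] E) (Q' : E →ₗ[𝕜] F') (x : E) : projR Δs Q' (projR Δs Q' x) = projR Δs Q' x := by
  obtain ⟨l, hl, h⟩ := exists_ker_projR_eq Δs Q' x
  rw [h, projR_apply_of_ker Δs Q' hl]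

end Projection

/-! ### The letters `Δ_{1,a}`, `G₁`, `(QG₁Q*)⁻¹`, `H₁`, `𝔊` on the `𝔤ᶜ`-valued lattice `L²` spaces -/

section LatticeLetters

open B9SectCLatticeCarrier (Bond)
open B4Sect5Torus (TSite)
open B11Eq111FrakG (frakGLin apply_Q_frakGLin apply_RDstar_frakGLin)

variable {𝕜 : Type*} [RCLike 𝕜] {d : ℕ} {Pd : Fin d → ℕ} {W : Type*} [NormedAddCommGroup W] [InnerProductSpace 𝕜 W] [FiniteDimensional 𝕜 W]
  {c₀ : ℝ} [Fact (0 < c₀)] {F : Type*} [NormedAddCommGroup F] [InnerProductSpace 𝕜 F] [FiniteDimensional 𝕜 F]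

/-- `Q†` is injective because `Q` is onto ([B9] (3.19) «Q′ onto»; [B5] p. 25 *«Q′*ω = 0, hence ω = 0»*), over `𝕜`: `‖y‖² = ⟨Qx, y⟩ = ⟨x, Q†y⟩ = 0`.
[cite: Balaban1985BackgroundPropagators, (3.19) p.393; Balaban1984PropagatorsI, p.25] -/
theorem adjoint_injective_of_surjective {E : Type*} [NormedAddCommGroup E] [InnerProductSpace 𝕜 E] [FiniteDimensional 𝕜 E]
    (Q : E →ₗ[𝕜] F) (hQ : Function.Surjective Q) : Function.Injective (LinearMap.adjoint Q) := by
  rw [← LinearMap.ker_eq_bot, LinearMap.ker_eq_bot']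
  intro y hy
  obtain ⟨x, rfl⟩ := hQ y
  have h : ⟪Q x, Q x⟫_𝕜 = 0 := by rw [← LinearMap.adjoint_inner_right, hy, inner_zero_right]
  exact inner_self_eq_zero.1 h

/-- **(3.23) the covariant Laplace operator `Δ^η_U = D*_U D_U` on the `𝔤ᶜ`-valued SITE functions** (gauge parameters), over `𝕜`.
[cite: Balaban1985BackgroundPropagators, (3.23) p.394] -/
def covLaplaceSiteK (c : 𝕜) (R S : Bond d Pd → W →ₗ[𝕜] W) : SiteL2K 𝕜 d Pd c₀ W →ₗ[𝕜] SiteL2K 𝕜 d Pd c₀ W :=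
  covDivL2K 𝕜 c₀ c S ∘ₗ covDerivL2K 𝕜 c₀ c R

/-- **`R = R(U)` OF (3.21) ON THE LATTICE**: the orthogonal projection onto `Δ^η_U N(Q′)` in `SiteL2K`, from the data `Q′` (the averaging (3.19) of
the gauge parameters) and the transporters — the `Rr` slot of `laplaceALatticeK` CONSTRUCTED modulo `Q′`. [cite: Balaban1985BackgroundPropagators, (3.21)–(3.23) p.394] -/
def RLatticeK {F' : Type*} [AddCommGroup F'] [Module 𝕜 F'] (c : 𝕜) (R S : Bond d Pd → W →ₗ[𝕜] W) (Q' : SiteL2K 𝕜 d Pd c₀ W →ₗ[𝕜] F') :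
    SiteL2K 𝕜 d Pd c₀ W →ₗ[𝕜] SiteL2K 𝕜 d Pd c₀ W :=
  projR (covLaplaceSiteK c R S) Q'

/-- The lattice `R` is symmetric (the hypothesis `hR` of `laplaceALatticeK_isSymmetric`, DISCHARGED for this `Rr`).
[cite: Balaban1985BackgroundPropagators, (3.21) p.394] -/
theorem RLatticeK_isSymmetric {F' : Type*} [AddCommGroup F'] [Module 𝕜 F'] (c : 𝕜) (R S : Bond d Pd → W →ₗ[𝕜] W)
    (Q' : SiteL2K 𝕜 d Pd c₀ W →ₗ[𝕜] F') : (RLatticeK c R S Q').IsSymmetric :=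
  projR_isSymmetric _ _

/-- **(3.21) on the lattice: `R(D*Dλ) = D*Dλ` for `Q′λ = 0`.** [cite: Balaban1985BackgroundPropagators, (3.21) p.394] -/
theorem RLatticeK_apply_of_ker {F' : Type*} [AddCommGroup F'] [Module 𝕜 F'] (c : 𝕜) (R S : Bond d Pd → W →ₗ[𝕜] W)
    (Q' : SiteL2K 𝕜 d Pd c₀ W →ₗ[𝕜] F') {l : SiteL2K 𝕜 d Pd c₀ W} (hl : Q' l = 0) :
    RLatticeK c R S Q' (covLaplaceSiteK c R S l) = covLaplaceSiteK c R S l :=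
  projR_apply_of_ker _ _ hl

/-- **`Δ_{1,a}` on the `𝔤ᶜ`-valued lattice `L²` spaces**: `laplaceAK` with `E := BondL2K`, `S := SiteL2K`, `D := covDerivL2K c R` ((3.3)),
`D* := covDivL2K c S` ((3.8) — `= D†` by `adjoint_covDerivL2K`), `Q* := Q†`, the real constant `a` acting as `(a : 𝕜)`; the Hessian `Δ₁`, the
restriction `R` (e.g. `RLatticeK c R S Q′`), the averaging `Q` and `a` remain DATA. [cite: Balaban1985Variational, (110) p.294; Balaban1985BackgroundPropagators, (3.26) p.395] -/
def laplaceALatticeK (c : 𝕜) (R S : Bond d Pd → W →ₗ[𝕜] W) (Δ₁ : BondL2K 𝕜 d Pd c₀ W →ₗ[𝕜] BondL2K 𝕜 d Pd c₀ W)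
    (Rr : SiteL2K 𝕜 d Pd c₀ W →ₗ[𝕜] SiteL2K 𝕜 d Pd c₀ W) (Q : BondL2K 𝕜 d Pd c₀ W →ₗ[𝕜] F) (a : ℝ) :
    BondL2K 𝕜 d Pd c₀ W →ₗ[𝕜] BondL2K 𝕜 d Pd c₀ W :=
  laplaceAK Δ₁ (covDerivL2K 𝕜 c₀ c R) Rr (covDivL2K 𝕜 c₀ c S) Q (LinearMap.adjoint Q) (a : 𝕜)

variable {c : 𝕜} {R S : Bond d Pd → W →ₗ[𝕜] W} {Δ₁ : BondL2K 𝕜 d Pd c₀ W →ₗ[𝕜] BondL2K 𝕜 d Pd c₀ W}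
  {Rr : SiteL2K 𝕜 d Pd c₀ W →ₗ[𝕜] SiteL2K 𝕜 d Pd c₀ W} {Q : BondL2K 𝕜 d Pd c₀ W →ₗ[𝕜] F} {a : ℝ}

/-- In the lattice instance the `D*` slot IS the Hilbert adjoint of the `D` slot: `Δ_{1,a} = Δ₁ + D ∘ R ∘ D† + Q† ∘ (aQ)`.
[cite: Balaban1985BackgroundPropagators, (3.8) p.392; Balaban1985Variational, p.293] -/
theorem laplaceALatticeK_eq_adjoint_form (hc : conj c = c) (hRS : ∀ (b : Bond d Pd) (v u : W), ⟪R b v, u⟫_𝕜 = ⟪v, S b u⟫_𝕜) :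
    laplaceALatticeK c R S Δ₁ Rr Q a =
      Δ₁ + covDerivL2K 𝕜 c₀ c R ∘ₗ Rr ∘ₗ LinearMap.adjoint (covDerivL2K 𝕜 c₀ c R) + LinearMap.adjoint Q ∘ₗ ((a : 𝕜) • Q) := by
  rw [laplaceALatticeK, laplaceAK, adjoint_covDerivL2K c hc R S hRS]

/-- **`Δ_{1,a}` is SYMMETRIC when `Δ₁` and `R` are** — [B11] p. 293's «scalar product defined by the operator Δ₁ + D*RD + aQ*Q» on `𝔤ᶜ`-valued
configurations. [cite: Balaban1985Variational, p.293] -/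
theorem laplaceALatticeK_isSymmetric (hc : conj c = c) (hRS : ∀ (b : Bond d Pd) (v u : W), ⟪R b v, u⟫_𝕜 = ⟪v, S b u⟫_𝕜) (hΔ : Δ₁.IsSymmetric)
    (hR : Rr.IsSymmetric) : (laplaceALatticeK c R S Δ₁ Rr Q a).IsSymmetric := by
  rw [laplaceALatticeK_eq_adjoint_form hc hRS]
  intro x y
  simp only [LinearMap.add_apply, LinearMap.comp_apply, LinearMap.smul_apply, inner_add_left, inner_add_right]
  refine congrArg₂ (· + ·) (congrArg₂ (· + ·) (hΔ x y) ?_) ?_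
  · rw [← LinearMap.adjoint_inner_right, hR, LinearMap.adjoint_inner_left]
  · rw [LinearMap.adjoint_inner_left, inner_smul_left, LinearMap.adjoint_inner_right, inner_smul_right, RCLike.conj_ofReal]

variable (hpos : ∀ x : BondL2K 𝕜 d Pd c₀ W, x ≠ 0 → 0 < RCLike.re ⟪x, laplaceALatticeK c R S Δ₁ Rr Q a x⟫_𝕜) (hQ : Function.Surjective Q)

/-- `⟨Qx, y⟩ = ⟨x, Q†y⟩` (the «hadj» of the abstract level is a theorem here). [cite: Balaban1985BackgroundPropagators, (3.19) p.393] -/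
theorem hadj_adjoint (x : BondL2K 𝕜 d Pd c₀ W) (y : F) : ⟪Q x, y⟫_𝕜 = ⟪x, LinearMap.adjoint Q y⟫_𝕜 :=
  (LinearMap.adjoint_inner_right Q x y).symm

/-- **`G₁` ON THE `𝔤ᶜ`-VALUED LATTICE `L²` SPACE** — `G1K` at the lattice data. [cite: Balaban1985Variational, (110) p.294] -/
def G1LatticeK : BondL2K 𝕜 d Pd c₀ W →ₗ[𝕜] BondL2K 𝕜 d Pd c₀ W :=
  G1K Δ₁ (covDerivL2K 𝕜 c₀ c R) Rr (covDivL2K 𝕜 c₀ c S) Q (LinearMap.adjoint Q) (a : 𝕜) hpos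

/-- `Δ_{1,a}(G₁x) = x` on the lattice. [cite: Balaban1985Variational, (110) p.294] -/
theorem laplaceALatticeK_G1LatticeK (x : BondL2K 𝕜 d Pd c₀ W) : laplaceALatticeK c R S Δ₁ Rr Q a (G1LatticeK hpos x) = x :=
  laplaceAK_G1K hpos x

/-- **`(QG₁Q*)⁻¹` ON THE LATTICE.** [cite: Balaban1985Variational, (45) p.285] -/
def KinvLatticeK : F →ₗ[𝕜] F :=
  KinvK (Δ := Δ₁) (D := covDerivL2K 𝕜 c₀ c R) (R := Rr) (Dstar := covDivL2K 𝕜 c₀ c S) (Q := Q) (Qadj := LinearMap.adjoint Q) (a := (a : 𝕜))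
    hpos hadj_adjoint (adjoint_injective_of_surjective Q hQ)

/-- **`QG₁Q*(QG₁Q*)⁻¹ = 1` on the lattice** — `B11Eq111FrakG`'s data relation `hK`, PROVED for the constructed letters.
[cite: Balaban1985Variational, (45) p.285] -/
theorem hK_lattice (y : F) : Q (G1LatticeK hpos (LinearMap.adjoint Q (KinvLatticeK hpos hQ y))) = y :=
  hKK_holds hpos hadj_adjoint (adjoint_injective_of_surjective Q hQ) y

/-- **`H₁` ON THE `𝔤ᶜ`-VALUED LATTICE `L²` SPACES** — (45)/(103)'s operator `F →ₗ BondL2K` determined by the DATA `Δ₁, R, Q, a`, the transporters,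
the displayed positivity ([B9] Thm 3.11) and `Q` onto ((3.19)). [cite: Balaban1985Variational, (45) p.285, (103) p.293] -/
def H1LatticeK : F →ₗ[𝕜] BondL2K 𝕜 d Pd c₀ W :=
  H1K (Δ := Δ₁) (D := covDerivL2K 𝕜 c₀ c R) (R := Rr) (Dstar := covDivL2K 𝕜 c₀ c S) (Q := Q) (Qadj := LinearMap.adjoint Q) (a := (a : 𝕜))
    hpos hadj_adjoint (adjoint_injective_of_surjective Q hQ)

/-- `H₁ = G₁ ∘ Q† ∘ (QG₁Q*)⁻¹` on the lattice, by `rfl`. [cite: Balaban1985Variational, (103) p.293] -/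
theorem H1LatticeK_eq : H1LatticeK hpos hQ = G1LatticeK hpos ∘ₗ LinearMap.adjoint Q ∘ₗ KinvLatticeK hpos hQ := rfl

/-- **(45) on the lattice: `Q(H₁b) = b`**, hypothesis-free given the data. [cite: Balaban1985Variational, (45) p.285] -/
theorem Q_H1LatticeK (b : F) : Q (H1LatticeK hpos hQ b) = b := Q_H1K hpos hadj_adjoint (adjoint_injective_of_surjective Q hQ) b

/-- **`𝔊 = 𝔓G₁` ON THE `𝔤ᶜ`-VALUED LATTICE `L²` SPACE** — `B11Eq111FrakG.frakGLin` AT THE CONSTRUCTED LETTERS `G₁ := G1LatticeK`, `Q* := Q†`,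
`Kinv := KinvLatticeK`, `D := (3.3)`, `D* := (3.8)`. [cite: Balaban1985Variational, (110)–(111) p.294; Balaban1985BackgroundPropagators, (3.153) p.426] -/
def frakGLatticeK : BondL2K 𝕜 d Pd c₀ W →ₗ[𝕜] BondL2K 𝕜 d Pd c₀ W :=
  frakGLin (G1LatticeK hpos) Q (LinearMap.adjoint Q) (KinvLatticeK hpos hQ) (covDerivL2K 𝕜 c₀ c R) Rr (covDivL2K 𝕜 c₀ c S)

/-- **`Q𝔊 = 0`** ([B11] p. 294) — `hK` discharged here, (3.124) `QG₁DR = 0` displayed. [cite: Balaban1985Variational, p.294] -/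
theorem Q_frakGLatticeK (h124 : ∀ s, Q (G1LatticeK hpos (covDerivL2K 𝕜 c₀ c R (Rr s))) = 0) (x : BondL2K 𝕜 d Pd c₀ W) :
    Q (frakGLatticeK hpos hQ x) = 0 :=
  apply_Q_frakGLin (hK_lattice hpos hQ) h124 x

/-- **`RD*𝔊 = 0`** ([B11] p. 294) — from the displayed `RD*G₁Q* = 0` and «`RD*G₁DR = R`» ([B9] (3.124)). [cite: Balaban1985Variational, p.294] -/
theorem RDstar_frakGLatticeK (h124' : ∀ y, Rr (covDivL2K 𝕜 c₀ c S (G1LatticeK hpos (LinearMap.adjoint Q y))) = 0)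
    (hRDR : ∀ s, Rr (covDivL2K 𝕜 c₀ c S (G1LatticeK hpos (covDerivL2K 𝕜 c₀ c R (Rr s)))) = Rr s) (x : BondL2K 𝕜 d Pd c₀ W) :
    Rr (covDivL2K 𝕜 c₀ c S (frakGLatticeK hpos hQ x)) = 0 :=
  apply_RDstar_frakGLin h124' hRDR x

end LatticeLetters

/-! ## §4 The letter (L6): `H₁` READ IN THE CONTINUOUS-LINEAR TYPE OF (115), and the data letters of `B11Eq111FrakG.frakG` CONSTRUCTED -/

section Carriers

open B11Eq115Space B11Eq111FrakG
open B9Eq311L2Pairing (WL2)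

variable {ι : Type*} {W : Type*} [AddCommGroup W] [Module ℂ W] {V : Type*} [AddCommGroup V] [Module ℂ V]

/-- **The Hilbert fibre read in the carrier fibre**: the weighted `L²` space of `W`-valued functions identified, along a linear fibre map
`φ : W ≃ₗ[ℂ] V`, with the plain functions `ι → V` — print's ONE space of `𝔤ᶜ`-valued lattice functions carrying the `L²` scalar product
(18) AND the operator-norm sizes (19)/(115) ([B7] p. 21). [cite: Balaban1985Averaging, (18)–(19) p.21] -/
def funEquiv (φ : W ≃ₗ[ℂ] V) (w : ι → ℝ) : WL2 ℂ w W ≃ₗ[ℂ] (ι → V) :=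
  (WL2.linearEquiv ℂ ℂ w).trans (LinearEquiv.piCongrRight fun _ : ι => φ)

/-- Unfolding: `funEquiv φ w f x = φ (f x)`. [cite: Balaban1985Averaging, (18)–(19) p.21] -/
@[simp] theorem funEquiv_apply (φ : W ≃ₗ[ℂ] V) (w : ι → ℝ) (f : WL2 ℂ w W) (x : ι) : funEquiv φ w f x = φ (WL2.equiv ℂ w W f x) := rfl

/-- Unfolding the inverse: `(funEquiv φ w)⁻¹ g x = φ⁻¹ (g x)`. [cite: Balaban1985Averaging, (18)–(19) p.21] -/
@[simp] theorem funEquiv_symm_apply (φ : W ≃ₗ[ℂ] V) (w : ι → ℝ) (g : ι → V) (x : ι) :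
    WL2.equiv ℂ w W ((funEquiv φ w).symm g) x = φ.symm (g x) := rfl

/-- A linear map between weighted `L²` spaces READ ON THE FUNCTIONS (conjugation by `funEquiv`): the same operator in the two normings (18)/(19) of the
`𝔤ᶜ`-valued functions. [cite: Balaban1985Averaging, (18)–(19) p.21] -/
def readFun {ι' : Type*} (φ : W ≃ₗ[ℂ] V) (w : ι → ℝ) (w' : ι' → ℝ) (T : WL2 ℂ w W →ₗ[ℂ] WL2 ℂ w' W) : (ι → V) →ₗ[ℂ] (ι' → V) :=
  (funEquiv φ w').toLinearMap ∘ₗ T ∘ₗ (funEquiv φ w).symm.toLinearMap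

/-- Unfolding `readFun`: conjugation by the identification of the two normings of the `𝔤ᶜ`-valued functions. [cite: Balaban1985Averaging, (18)–(19) p.21] -/
theorem readFun_apply {ι' : Type*} (φ : W ≃ₗ[ℂ] V) (w : ι → ℝ) (w' : ι' → ℝ) (T : WL2 ℂ w W →ₗ[ℂ] WL2 ℂ w' W) (g : ι → V) :
    readFun φ w w' T g = funEquiv φ w' (T ((funEquiv φ w).symm g)) := rfl

/-- `G₁` read on the functions `ι → V` along `φ` (the `G₁` slot of `B11Eq111FrakG.frakG`). [cite: Balaban1985Variational, (110) p.294] -/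
abbrev G1Fun (φ : W ≃ₗ[ℂ] V) {w : ι → ℝ} (G₁ : WL2 ℂ w W →ₗ[ℂ] WL2 ℂ w W) : (ι → V) →ₗ[ℂ] (ι → V) := readFun φ w w G₁

/-- `Q` read on the functions (the block-field space kept at the Hilbert level `F := WL2 ℂ w_B W`). [cite: Balaban1985BackgroundPropagators, (3.15) p.393] -/
abbrev QFun {β : Type*} (φ : W ≃ₗ[ℂ] V) {w : ι → ℝ} {wB : β → ℝ} (Q : WL2 ℂ w W →ₗ[ℂ] WL2 ℂ wB W) : (ι → V) →ₗ[ℂ] WL2 ℂ wB W :=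
  Q ∘ₗ (funEquiv φ w).symm.toLinearMap

/-- `D` read on the functions (the gauge parameters kept at the Hilbert level `S`). [cite: Balaban1985BackgroundPropagators, (3.3) p.391] -/
abbrev DFun {S : Type*} [AddCommGroup S] [Module ℂ S] (φ : W ≃ₗ[ℂ] V) {w : ι → ℝ} (D : S →ₗ[ℂ] WL2 ℂ w W) : S →ₗ[ℂ] (ι → V) :=
  (funEquiv φ w).toLinearMap ∘ₗ D

/-- `D*` read on the functions. [cite: Balaban1985BackgroundPropagators, (3.8) p.392] -/
abbrev DstarFun {S : Type*} [AddCommGroup S] [Module ℂ S] (φ : W ≃ₗ[ℂ] V) {w : ι → ℝ} (Dstar : WL2 ℂ w W →ₗ[ℂ] S) : (ι → V) →ₗ[ℂ] S :=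
  Dstar ∘ₗ (funEquiv φ w).symm.toLinearMap

/-- The (3.124)-identity `QG₁DR = 0` transfers to the read letters. [cite: Balaban1985Variational, p.294] -/
theorem h124_fun {β S : Type*} [AddCommGroup S] [Module ℂ S] (φ : W ≃ₗ[ℂ] V) {w : ι → ℝ} {wB : β → ℝ} {G₁ : WL2 ℂ w W →ₗ[ℂ] WL2 ℂ w W}
    {Q : WL2 ℂ w W →ₗ[ℂ] WL2 ℂ wB W} {D : S →ₗ[ℂ] WL2 ℂ w W} {Rr : S →ₗ[ℂ] S} (h124 : ∀ s, Q (G₁ (D (Rr s))) = 0) (s : S) :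
    QFun φ Q (G1Fun φ G₁ (DFun φ D (Rr s))) = 0 := by
  simp only [QFun, G1Fun, DFun, LinearMap.comp_apply, LinearEquiv.coe_coe, readFun_apply, LinearEquiv.symm_apply_apply]
  exact h124 s

end Carriers

section Letter

open B11Eq115Space B11Eq111FrakG
open B9Eq311L2Pairing (WL2)
open B9SectCLatticeCarrier (Bond)
open B4Sect5Torus (TSite)

variable {ι β κ : Type*} [Fintype ι] [Fintype β] [Fintype κ] {V : Type*} [NormedAddCommGroup V] [NormedSpace ℂ V] [FiniteDimensional ℂ V]
  {L η : ℝ} [Fact (0 < L)] [Fact (0 < η)] {lev₀ : ι → ℕ} {levB : β → ℕ}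

/-- A linear map of functions `(β → V) → (ι → V)` READ AS A CONTINUOUS LINEAR MAP from the block fields `|·|_{(−0)} = sup|·|` on `β` to the space
(115) on `ι` (ANY derivative letter `Dc`) — continuity is automatic on the finite lattice; the block-field analogue of `B11Eq111FrakG.toCLM115`.
[cite: Balaban1985Variational, (103) p.293, (115) p.294] -/
def blockCLM115 (lev₁ : κ → ℕ) (Dc : (ι → V) →ₗ[ℂ] (κ → V)) (T : (β → V) →ₗ[ℂ] (ι → V)) :
    NegSize L η levB 0 V →L[ℂ] Space115 L η lev₀ lev₁ Dc :=
  LinearMap.toContinuousLinearMap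
    ((jetLinearEquiv L η lev₀ lev₁ Dc).symm.toLinearMap ∘ₗ T ∘ₗ
      (NegSup.linearEquiv ℂ (levWeight L η levB 0) : NegSize L η levB 0 V ≃ₗ[ℂ] (β → V)).toLinearMap)

/-- Unfolding: the configuration underlying `blockCLM115 T B` is `T` applied to the block function underlying `B`. [cite: Balaban1985Variational, (103) p.293] -/
@[simp] theorem blockCLM115_apply (lev₁ : κ → ℕ) (Dc : (ι → V) →ₗ[ℂ] (κ → V)) (T : (β → V) →ₗ[ℂ] (ι → V)) (B : NegSize L η levB 0 V) :
    JetSup.equiv _ _ Dc (blockCLM115 (L := L) (η := η) (lev₀ := lev₀) lev₁ Dc T B) = T (NegSup.equiv _ V B) := rfl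

variable {W : Type*} [NormedAddCommGroup W] [InnerProductSpace ℂ W] (φ : W ≃ₗ[ℂ] V) {wι : ι → ℝ} {wB : β → ℝ}

/-- **THE LETTER (L6): `H₁` IN THE CONTINUOUS-LINEAR TYPE OF (115)** — a linear `H₁ : WL2 ℂ wB W →ₗ[ℂ] WL2 ℂ wι W` (block fields on `β` to
configurations on `ι`, Hilbert level; e.g. `H1LatticeK …` at `ι := Bond d Pd`) READ as `NegSize L η levB 0 V →L[ℂ] Space115 L η lev₀ lev₁ Dc` along the
fibre identification `φ` — the `H₁` slot of `B11Eq115Space.chartHB115` / `B11Eq174Chart.chartHB` (174). [cite: Balaban1985Variational, (103) p.293, (174) p.305] -/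
def H1CLM (lev₁ : κ → ℕ) (Dc : (ι → V) →ₗ[ℂ] (κ → V)) (H₁ : WL2 ℂ wB W →ₗ[ℂ] WL2 ℂ wι W) :
    NegSize L η levB 0 V →L[ℂ] Space115 L η lev₀ lev₁ Dc :=
  blockCLM115 lev₁ Dc (readFun φ wB wι H₁)

/-- Unfolding: the configuration underlying `H1CLM … H₁ B` at a point is `φ` of the Hilbert-level `H₁` applied to `φ⁻¹ ∘ B`.
[cite: Balaban1985Variational, (103) p.293] -/
theorem H1CLM_apply (lev₁ : κ → ℕ) (Dc : (ι → V) →ₗ[ℂ] (κ → V)) (H₁ : WL2 ℂ wB W →ₗ[ℂ] WL2 ℂ wι W) (B : NegSize L η levB 0 V) (x : ι) :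
    JetSup.equiv _ _ Dc (H1CLM (L := L) (η := η) (lev₀ := lev₀) φ lev₁ Dc H₁ B) x =
      φ (WL2.equiv ℂ wι W (H₁ ((funEquiv φ wB).symm (NegSup.equiv _ V B))) x) := rfl

/-- **(45) IN THE (115) READING: `Q(H₁B) = B` on the underlying functions** — for any Hilbert-level pair with `Q(H₁b) = b` (e.g.
`Q_H1LatticeK`), the averaging READ ON THE FUNCTIONS (`readFun φ … Q`) returns the block field. [cite: Balaban1985Variational, (45) p.285] -/
theorem Q_H1CLM (lev₁ : κ → ℕ) (Dc : (ι → V) →ₗ[ℂ] (κ → V)) {H₁ : WL2 ℂ wB W →ₗ[ℂ] WL2 ℂ wι W} {Q : WL2 ℂ wι W →ₗ[ℂ] WL2 ℂ wB W}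
    (hQH : ∀ b, Q (H₁ b) = b) (B : NegSize L η levB 0 V) :
    readFun φ wι wB Q (JetSup.equiv _ _ Dc (H1CLM (L := L) (η := η) (lev₀ := lev₀) φ lev₁ Dc H₁ B)) = NegSup.equiv _ V B := by
  show funEquiv φ wB (Q ((funEquiv φ wι).symm (funEquiv φ wι (H₁ ((funEquiv φ wB).symm (NegSup.equiv _ V B)))))) = _
  rw [LinearEquiv.symm_apply_apply, hQH, LinearEquiv.apply_symm_apply]

/-! ### The data letters of `B11Eq111FrakG.frakG`, CONSTRUCTED (function level), and the joint typecheck with (L2) -/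

variable [FiniteDimensional ℂ W] [Fact (∀ x, 0 < wι x)] [Fact (∀ y, 0 < wB y)] {S : Type*} [AddCommGroup S] [Module ℂ S]

/-- `Q* := Q†` (the Hilbert adjoint in the weighted `L²` spaces) read on the functions. [cite: Balaban1985BackgroundPropagators, p.391] -/
abbrev QadjFun (Q : WL2 ℂ wι W →ₗ[ℂ] WL2 ℂ wB W) : WL2 ℂ wB W →ₗ[ℂ] (ι → V) := (funEquiv φ wι).toLinearMap ∘ₗ LinearMap.adjoint Q

omit [FiniteDimensional ℂ V] in
/-- **The data relation `hK` of `B11Eq111FrakG` HOLDS for the read letters** whenever it holds at the Hilbert level (e.g. `hK_lattice`):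
`Q(G₁(Q*(K⁻¹y))) = y`. [cite: Balaban1985Variational, (45) p.285] -/
theorem hK_fun {G₁ : WL2 ℂ wι W →ₗ[ℂ] WL2 ℂ wι W} {Q : WL2 ℂ wι W →ₗ[ℂ] WL2 ℂ wB W} {Kinv : WL2 ℂ wB W →ₗ[ℂ] WL2 ℂ wB W}
    (hK : ∀ y, Q (G₁ (LinearMap.adjoint Q (Kinv y))) = y) (y : WL2 ℂ wB W) :
    QFun φ Q (G1Fun φ G₁ (QadjFun φ Q (Kinv y))) = y := by
  simp only [QFun, G1Fun, QadjFun, LinearMap.comp_apply, LinearEquiv.coe_coe, readFun_apply, LinearEquiv.symm_apply_apply]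
  exact hK y

/-- **(L2) AND (L6) MEET IN ONE CHART**: with the data letters read on the functions, lit-balaban's chart (174) on the concrete carriers
`chartHB115 (frakG lev₁ Dc G₁ Q Q* K⁻¹ D R D*) Λ W J T ε₄ (H1CLM φ lev₁ Dc H₁)` is a well-typed map `NegSize L η levB 0 V → Space115 L η lev₀ lev₁ Dc`
for ANY derivative letter `Dc` (at `Dc := nabla115 η U₀`, `V := 𝔸 ⊇ 𝔤ᶜ`: the types of INTERFACE REQUEST NE9 (L2)/(L6)) — this definition IS the
typecheck. [cite: Balaban1985Variational, (174) p.305, (111) p.294, (103) p.293] -/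
def chartOfLetters (lev₁ : κ → ℕ) (Dc : (ι → V) →ₗ[ℂ] (κ → V)) (G₁ : WL2 ℂ wι W →ₗ[ℂ] WL2 ℂ wι W)
    (Q : WL2 ℂ wι W →ₗ[ℂ] WL2 ℂ wB W) (Kinv : WL2 ℂ wB W →ₗ[ℂ] WL2 ℂ wB W) (D : S →ₗ[ℂ] WL2 ℂ wι W) (Rr : S →ₗ[ℂ] S)
    (Dstar : WL2 ℂ wι W →ₗ[ℂ] S) (H₁ : WL2 ℂ wB W →ₗ[ℂ] WL2 ℂ wι W)
    (Λ : Space115 L η lev₀ lev₁ Dc →L[ℂ] Space115 L η lev₀ lev₁ Dc) (Wq : Space115 L η lev₀ lev₁ Dc → NegSize L η lev₀ 3 V)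
    (J : NegSize L η lev₀ 3 V) (T : Space115 L η lev₀ lev₁ Dc → Space115 L η lev₀ lev₁ Dc) (ε₄ : ℝ) :
    NegSize L η levB 0 V → Space115 L η lev₀ lev₁ Dc :=
  chartHB115 (frakG lev₁ Dc (G1Fun φ G₁) (QFun φ Q) (QadjFun φ Q) Kinv (DFun φ D) Rr (DstarFun φ Dstar)) Λ Wq J T ε₄
    (H1CLM φ lev₁ Dc H₁)

/-- The chart of the letters IS lit-balaban's `chartHB115` at them (by `rfl`). [cite: Balaban1985Variational, (174) p.305] -/
theorem chartOfLetters_eq (lev₁ : κ → ℕ) (Dc : (ι → V) →ₗ[ℂ] (κ → V)) (G₁ : WL2 ℂ wι W →ₗ[ℂ] WL2 ℂ wι W)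
    (Q : WL2 ℂ wι W →ₗ[ℂ] WL2 ℂ wB W) (Kinv : WL2 ℂ wB W →ₗ[ℂ] WL2 ℂ wB W) (D : S →ₗ[ℂ] WL2 ℂ wι W) (Rr : S →ₗ[ℂ] S)
    (Dstar : WL2 ℂ wι W →ₗ[ℂ] S) (H₁ : WL2 ℂ wB W →ₗ[ℂ] WL2 ℂ wι W)
    (Λ : Space115 L η lev₀ lev₁ Dc →L[ℂ] Space115 L η lev₀ lev₁ Dc) (Wq : Space115 L η lev₀ lev₁ Dc → NegSize L η lev₀ 3 V)
    (J : NegSize L η lev₀ 3 V) (T : Space115 L η lev₀ lev₁ Dc → Space115 L η lev₀ lev₁ Dc) (ε₄ : ℝ) :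
    chartOfLetters (levB := levB) φ lev₁ Dc G₁ Q Kinv D Rr Dstar H₁ Λ Wq J T ε₄ =
      chartHB115 (frakG lev₁ Dc (G1Fun φ G₁) (QFun φ Q) (QadjFun φ Q) Kinv (DFun φ D) Rr (DstarFun φ Dstar)) Λ Wq J T ε₄
        (H1CLM φ lev₁ Dc H₁) :=
  rfl

end Letter

/-! ### The letter at the lattice data: `ι := Bond d Pd`, `H₁ := H1LatticeK`, `G₁ := G1LatticeK`, `K⁻¹ := KinvLatticeK` -/

section LatticeLetter

open B11Eq115Space B11Eq111FrakG
open B9Eq311L2Pairing (WL2)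
open B9SectCLatticeCarrier (Bond)
open B4Sect5Torus (TSite)

variable {d : ℕ} {Pd : Fin d → ℕ} {β κ : Type*} [Fintype β] [Fintype κ] {V : Type*} [NormedAddCommGroup V] [NormedSpace ℂ V]
  [FiniteDimensional ℂ V] {W : Type*} [NormedAddCommGroup W] [InnerProductSpace ℂ W] [FiniteDimensional ℂ W] (φ : W ≃ₗ[ℂ] V)
  {L η : ℝ} [Fact (0 < L)] [Fact (0 < η)] {lev₀ : Bond d Pd → ℕ} {levB : β → ℕ} {c₀ : ℝ} [Fact (0 < c₀)] {wB : β → ℝ} [Fact (∀ y, 0 < wB y)]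
  {c : ℂ} {R S : Bond d Pd → W →ₗ[ℂ] W} {Δ₁ : BondL2K ℂ d Pd c₀ W →ₗ[ℂ] BondL2K ℂ d Pd c₀ W}
  {Rr : SiteL2K ℂ d Pd c₀ W →ₗ[ℂ] SiteL2K ℂ d Pd c₀ W} {Q : BondL2K ℂ d Pd c₀ W →ₗ[ℂ] WL2 ℂ wB W} {a : ℝ}
  (hpos : ∀ x : BondL2K ℂ d Pd c₀ W, x ≠ 0 → 0 < RCLike.re ⟪x, laplaceALatticeK c R S Δ₁ Rr Q a x⟫_ℂ) (hQ : Function.Surjective Q)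

/-- **(L6) AT THE LATTICE DATA: `H₁ = G₁Q*(QG₁Q*)⁻¹` of the `𝔤ᶜ`-valued lattice `L²` spaces in the type
`NegSize L η levB 0 V →L[ℂ] Space115 L η lev₀ lev₁ Dc`** (`Dc` arbitrary; at `Dc := nabla115 η U₀` the requested letter), determined by the DATA
`Δ₁, R, Q, a`, the transporters, the displayed positivity and `Q` onto. [cite: Balaban1985Variational, (45) p.285, (103) p.293, (174) p.305] -/
def H1LatticeCLM (lev₁ : κ → ℕ) (Dc : (Bond d Pd → V) →ₗ[ℂ] (κ → V)) : NegSize L η levB 0 V →L[ℂ] Space115 L η lev₀ lev₁ Dc :=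
  H1CLM φ lev₁ Dc (H1LatticeK hpos hQ)

/-- **(45) for the lattice letter**: `Q(H₁B) = B` read on the functions, hypothesis-free given the data. [cite: Balaban1985Variational, (45) p.285] -/
theorem Q_H1LatticeCLM (lev₁ : κ → ℕ) (Dc : (Bond d Pd → V) →ₗ[ℂ] (κ → V)) (B : NegSize L η levB 0 V) :
    readFun φ _ wB Q (JetSup.equiv _ _ Dc (H1LatticeCLM (L := L) (η := η) (lev₀ := lev₀) φ hpos hQ lev₁ Dc B)) = NegSup.equiv _ V B :=
  Q_H1CLM φ lev₁ Dc (Q_H1LatticeK hpos hQ) B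

/-- **`𝔊` OF `B11Eq111FrakG` WITH CONSTRUCTED LETTERS**: `frakG lev₁ Dc G₁ Q Q* K⁻¹ D R D*` at `G₁ := G1LatticeK`, `K⁻¹ := KinvLatticeK`, `Q* := Q†`,
`D := (3.3)`, `D* := (3.8)` read on the functions — only `Δ₁, R, Q, a` and the transporters remain data. [cite: Balaban1985Variational, (111) p.294, (116)–(117) p.295] -/
def frakGLatticeCLM (lev₁ : κ → ℕ) (Dc : (Bond d Pd → V) →ₗ[ℂ] (κ → V)) : NegSize L η lev₀ 3 V →L[ℂ] Space115 L η lev₀ lev₁ Dc :=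
  frakG lev₁ Dc (G1Fun φ (G1LatticeK hpos)) (QFun φ Q) (QadjFun φ Q) (KinvLatticeK hpos hQ)
    (DFun φ (covDerivL2K ℂ c₀ c R)) Rr (DstarFun φ (covDivL2K ℂ c₀ c S))

/-- **`Q𝔊 = 0`, `RD*𝔊 = 0` for the constructed `𝔊`, in the (115) reading**: its range lies in the constraint subspace (102) — `B11Eq111FrakG.frakG_mem_constraint102`
with `hK` DISCHARGED (`hK_lattice`) and the (3.124)-identities displayed. [cite: Balaban1985Variational, (110)–(111) p.294] -/
theorem frakGLatticeCLM_mem_constraint102 (lev₁ : κ → ℕ) (Dc : (Bond d Pd → V) →ₗ[ℂ] (κ → V))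
    (h124 : ∀ s, Q (G1LatticeK hpos (covDerivL2K ℂ c₀ c R (Rr s))) = 0)
    (h124' : ∀ y, Rr (covDivL2K ℂ c₀ c S (G1LatticeK hpos (LinearMap.adjoint Q y))) = 0)
    (hRDR : ∀ s, Rr (covDivL2K ℂ c₀ c S (G1LatticeK hpos (covDerivL2K ℂ c₀ c R (Rr s)))) = Rr s) (f : NegSize L η lev₀ 3 V) :
    frakGLatticeCLM (L := L) (η := η) (lev₀ := lev₀) φ hpos hQ lev₁ Dc f ∈
      constraint102 lev₁ Dc (QFun φ Q) Rr (DstarFun φ (covDivL2K ℂ c₀ c S)) := by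
  refine frakG_mem_constraint102 lev₁ Dc (hK_fun φ (hK_lattice hpos hQ)) (h124_fun φ h124) (fun y => ?_) (fun s => ?_) f
  · simp only [G1Fun, QadjFun, DstarFun, LinearMap.comp_apply, LinearEquiv.coe_coe, readFun_apply, LinearEquiv.symm_apply_apply]
    exact h124' y
  · simp only [G1Fun, DFun, DstarFun, LinearMap.comp_apply, LinearEquiv.coe_coe, readFun_apply, LinearEquiv.symm_apply_apply]
    exact hRDR s

end LatticeLetter

end Literature.MathematicalPhysics.QuantumFieldTheory.Balaban1983to89.B11Eq103H1Complex

end
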